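import Literature.NumberTheory.LocalFields.UnramifiedQuadraticNormResidueShiftPairs
import HarnessLib

/-!
# Norms prescribed modulo `𝔪^j` BEYOND the level (`m < j ≤ m + ℓ`): the residue count of Flicker's Prop. 13, case (e) — FILE 9 of `UnramifiedQuadraticNorm*`
(Flicker (1998), *Elementary proof of the fundamental lemma for a unitary group*, Prop. 13 p. 93, case (e); Serre, *Local Fields*, V §2)

Topic `NumberTheory/LocalFields`, namespace `Literature.NumberTheory.LocalFields.UnramifiedQuadraticNorm`.  THEOREMS ONLY; kernel lane.  Pen F0P3b-p01 (g6) (A-p03 (g24)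
05:41:12Z: «(e) at precision `k = 2m − N > m` is STILL a `ρ_m`-count»).  HONEST LABEL: HC_CM is proved only modulo the 2 remaining named inputs (hLiu418, h413) until rung
0 closes; elementary DVR counting.

THE POINT.  For `2ℓ < j ≤ m + ℓ` the condition «`N(w) ≡ ϖ^{2ℓ}γ (mod 𝔪^j)`» on an element `w ∈ R` forces `ϖ^ℓ ∣ w` (★ `shift_dvd_of_norm_congr`) and is then STABLE under
`w ↦ w + ϖ^m s` (`N(w + ϖ^m s) − N(w) ∈ ϖ^{m+ℓ}R ⊆ ϖ^j R`, `norm_sub_norm_dvd`), so «some lift satisfies it» = «every lift satisfies it» is a predicate on `R ⧸ 𝔪^m`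
even though `j > m`; its count is again the shifted one: `#{z ∈ R ⧸ 𝔪^m : ∃ w ↦ z, ϖ^j ∣ N(w) − ϖ^{2ℓ}γ} = q^{(m−ℓ)−(j−2ℓ)} · q^{m−ℓ−1}(q+1)`
(`natCard_norm_congr_shift_exists`; at `j ≤ m` it is ★ FILE 7's count).  With `j = 2m − N`, `2ℓ = M − N` (case (e): `N < m`, `M < 2m ≤ M + N`): `(q+1)q^{N−1}`·(shift-free).

## References
* [Flicker1998UnitaryFL] Y. Z. Flicker, *Elementary proof of the fundamental lemma for a unitary group*, Canad. J. Math. 50 (1998), 74–98: Prop. 13 p. 93.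
* [Serre1979] J.-P. Serre, *Local Fields*, GTM 67 (1979), Ch. V §2 Prop. 2–3.
-/

set_option autoImplicit false

namespace Literature.NumberTheory.LocalFields.UnramifiedQuadraticNorm

open Literature.LinearAlgebra.Matrix.HermitianFormsHensel Literature.NumberTheory.GaloisRepresentations IsLocalRing

universe u

variable {R : Type u} [CommRing R] (σ : R →+* R)

section Perturb

/-- **Perturbation**: if `ϖ^ℓ ∣ w` and `ϖ^m ∣ w′ − w` (`ℓ ≤ m`, `σϖ = ϖ`), then `ϖ^{m+ℓ} ∣ N(w′) − N(w)` (`N(x) = xσx`). [cite: Flicker1998UnitaryFL, Prop. 13 p. 93] -/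
theorem norm_sub_norm_dvd {p : R} (hσp : σ p = p) {ℓ m : ℕ} (hℓm : ℓ ≤ m) {w w' : R} (hw : p ^ ℓ ∣ w) (hww : p ^ m ∣ w' - w) :
    p ^ (m + ℓ) ∣ w' * σ w' - w * σ w := by
  obtain ⟨w₁, rfl⟩ := hw
  obtain ⟨s, hs⟩ := hww
  obtain ⟨d, rfl⟩ := Nat.exists_eq_add_of_le hℓm
  have hw' : w' = p ^ ℓ * w₁ + p ^ (ℓ + d) * s := by rw [← hs]; ring
  rw [hw', map_add, map_mul, map_mul, map_pow, map_pow, hσp]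
  have : (p ^ ℓ * w₁ + p ^ (ℓ + d) * s) * (p ^ ℓ * σ w₁ + p ^ (ℓ + d) * σ s) - p ^ ℓ * w₁ * (p ^ ℓ * σ w₁) =
      p ^ (ℓ + d + ℓ) * (w₁ * σ s + s * σ w₁ + p ^ d * (s * σ s)) := by ring
  rw [this]; exact Dvd.intro _ rfl

end Perturb

section Count

variable [IsDomain R] [IsDiscreteValuationRing R] [Finite (ResidueField R)] [IsAdicComplete (maximalIdeal R) R]
  (hσ : ∀ a, σ (σ a) = a) {a : R} (ha : IsUnit (σ a - a)) {q : ℕ} (hq : Nat.card (ResidueField R) = q ^ 2)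

include hσ ha hq in
/-- **`#{z ∈ R ⧸ 𝔪^m : some lift w has ϖ^j ∣ N(w) − ϖ^{2ℓ}γ} = q^{(m−ℓ)−(j−2ℓ)} · q^{m−ℓ−1}(q+1)`** for `2ℓ < j ≤ m + ℓ`, `γ ∈ (R^σ)^×`, `ϖ` a `σ`-fixed uniformiser —
the precision may EXCEED the level by `ℓ` (case (e) of Prop. 13: `j = 2m − N > m`).  Same bijection as ★ `natCard_norm_congr_shift` (`z = ϖ^ℓ z₁`, `z₁ mod 𝔪^{m−ℓ}` of norm
`≡ γ (mod 𝔪^{j−2ℓ})`, `j − 2ℓ ≤ m − ℓ`), the lift-independence by `norm_sub_norm_dvd`. [cite: Flicker1998UnitaryFL, Prop. 13 p. 93] [cite: Serre1979, Ch. V §2 Prop. 3] -/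
theorem natCard_norm_congr_shift_exists {p : R} (hp : Irreducible p) (hσp : σ p = p) {m j ℓ : ℕ} (hj : 2 * ℓ < j) (hjm : j ≤ m + ℓ)
    {γ : R} (hγ : IsUnit γ) (hσγ : σ γ = γ) :
    Nat.card {z : R ⧸ maximalIdeal R ^ m // ∃ w : R, Ideal.Quotient.mk (maximalIdeal R ^ m) w = z ∧ p ^ j ∣ w * σ w - p ^ (2 * ℓ) * γ} =
      q ^ ((m - ℓ) - (j - 2 * ℓ)) * (q ^ ((m - ℓ) - 1) * (q + 1)) := by
  classical
  have hℓm : ℓ ≤ m := by omega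
  have hk : 1 ≤ j - 2 * ℓ := by omega
  have hkm : j - 2 * ℓ ≤ m - ℓ := by omega
  rw [← natCard_norm_congr_quotient_pow σ hσ ha hq hk hkm hγ hσγ]
  set m' := m - ℓ with hm'
  set k' := j - 2 * ℓ with hk'
  have hmm : ℓ + m' = m := by omega
  have hjj : 2 * ℓ + k' = j := by omega
  set σm' := Ideal.quotientMap (maximalIdeal R ^ m') σ (maximalIdeal_pow_le_comap σ hσ m') with hσm'
  -- the multiplication-by-`ϖ^ℓ` map `g : R ⧸ 𝔪^{m'} → R ⧸ 𝔪^m`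
  have hker : maximalIdeal R ^ m' ≤ LinearMap.ker ((Submodule.mkQ (maximalIdeal R ^ m)).comp (LinearMap.mulLeft R (p ^ ℓ))) := by
    intro w hw
    rw [LinearMap.mem_ker, LinearMap.comp_apply, LinearMap.mulLeft_apply, Submodule.mkQ_apply, Submodule.Quotient.mk_eq_zero,
      mem_maximalIdeal_pow_iff_pow_dvd hp]
    rw [mem_maximalIdeal_pow_iff_pow_dvd hp] at hw
    rw [← hmm, pow_add]
    exact mul_dvd_mul_left _ hw
  set g : R ⧸ maximalIdeal R ^ m' →ₗ[R] R ⧸ maximalIdeal R ^ m :=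
    Submodule.liftQ (maximalIdeal R ^ m') ((Submodule.mkQ (maximalIdeal R ^ m)).comp (LinearMap.mulLeft R (p ^ ℓ))) hker with hg
  have hgmk : ∀ w : R, g (Ideal.Quotient.mk (maximalIdeal R ^ m') w) = Ideal.Quotient.mk (maximalIdeal R ^ m) (p ^ ℓ * w) := fun w => by
    rw [hg, ← Ideal.Quotient.mk_eq_mk, Submodule.liftQ_apply]; rfl
  -- the predicates
  set Pm : R ⧸ maximalIdeal R ^ m → Prop := fun z =>
    ∃ w : R, Ideal.Quotient.mk (maximalIdeal R ^ m) w = z ∧ p ^ j ∣ w * σ w - p ^ (2 * ℓ) * γ with hPm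
  set Pm' : R ⧸ maximalIdeal R ^ m' → Prop := fun z =>
    Ideal.Quotient.factor (Ideal.pow_le_pow_right hkm) (z * σm' z) = Ideal.Quotient.mk (maximalIdeal R ^ k') γ with hPm'
  -- `Pm'` in divisibility terms
  have hPm'iff : ∀ w : R, Pm' (Ideal.Quotient.mk _ w) ↔ p ^ k' ∣ w * σ w - γ := by
    intro w
    simp only [hPm', hσm', Ideal.quotientMap_mk, ← map_mul, Ideal.Quotient.factor_mk, Ideal.Quotient.eq, mem_maximalIdeal_pow_iff_pow_dvd hp]
  -- the norm of `ϖ^ℓ w`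
  have hNshift : ∀ w : R, p ^ ℓ * w * σ (p ^ ℓ * w) - p ^ (2 * ℓ) * γ = p ^ (2 * ℓ) * (w * σ w - γ) := fun w => by
    rw [map_mul, map_pow, hσp]; ring
  have hdiv : ∀ w : R, p ^ j ∣ p ^ ℓ * w * σ (p ^ ℓ * w) - p ^ (2 * ℓ) * γ ↔ p ^ k' ∣ w * σ w - γ := fun w => by
    rw [hNshift, ← hjj, pow_add]; exact mul_dvd_mul_iff_left (pow_ne_zero _ hp.ne_zero)
  -- the two predicates correspond under `g`
  have hiff : ∀ w : R, Pm (g (Ideal.Quotient.mk _ w)) ↔ Pm' (Ideal.Quotient.mk _ w) := by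
    intro w
    rw [hPm'iff, hgmk]
    constructor
    · rintro ⟨w₂, hw₂, hdw₂⟩
      -- `w₂ ≡ ϖ^ℓ w (mod 𝔪^m)`, `ϖ^ℓ ∣ w₂`
      have hℓ2 : p ^ ℓ ∣ w₂ := shift_dvd_of_norm_congr σ hp hσp hj γ hdw₂
      have hmw : p ^ m ∣ p ^ ℓ * w - w₂ := by
        rw [← mem_maximalIdeal_pow_iff_pow_dvd hp, ← Ideal.Quotient.eq, hw₂]
      have hpert := norm_sub_norm_dvd σ hσp hℓm hℓ2 hmw
      have hjd : p ^ j ∣ (p ^ ℓ * w) * σ (p ^ ℓ * w) - w₂ * σ w₂ := dvd_trans (pow_dvd_pow p hjm) hpert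
      have : p ^ j ∣ p ^ ℓ * w * σ (p ^ ℓ * w) - p ^ (2 * ℓ) * γ := by
        have e1 : p ^ ℓ * w * σ (p ^ ℓ * w) - p ^ (2 * ℓ) * γ = (p ^ ℓ * w * σ (p ^ ℓ * w) - w₂ * σ w₂) + (w₂ * σ w₂ - p ^ (2 * ℓ) * γ) := by ring
        rw [e1]; exact dvd_add hjd hdw₂
      exact (hdiv w).1 this
    · intro hw
      exact ⟨p ^ ℓ * w, rfl, (hdiv w).2 hw⟩
  -- the bijection `S' → T`, `z₁ ↦ ϖ^ℓ z₁`
  refine (Nat.card_congr (Equiv.ofBijective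
    (fun z : {z : R ⧸ maximalIdeal R ^ m' // Pm' z} => (⟨g z.1, ?_⟩ : {z : R ⧸ maximalIdeal R ^ m // Pm z})) ⟨?_, ?_⟩)).symm
  · obtain ⟨w, hw⟩ := Ideal.Quotient.mk_surjective z.1
    have h := z.2
    rw [← hw] at h ⊢
    exact (hiff w).2 h
  · rintro ⟨z₁, h₁⟩ ⟨z₂, h₂⟩ h
    have h' : g z₁ = g z₂ := congrArg (fun x => x.1) h
    obtain ⟨w₁, rfl⟩ := Ideal.Quotient.mk_surjective z₁
    obtain ⟨w₂, rfl⟩ := Ideal.Quotient.mk_surjective z₂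
    apply Subtype.ext
    rw [hgmk, hgmk, Ideal.Quotient.eq, mem_maximalIdeal_pow_iff_pow_dvd hp, ← mul_sub, ← hmm, pow_add] at h'
    show Ideal.Quotient.mk _ w₁ = Ideal.Quotient.mk _ w₂
    rw [Ideal.Quotient.eq, mem_maximalIdeal_pow_iff_pow_dvd hp]
    exact (mul_dvd_mul_iff_left (pow_ne_zero _ hp.ne_zero)).1 h'
  · rintro ⟨z, hz⟩
    obtain ⟨w, hwz, hdw⟩ := hz
    subst hwz
    obtain ⟨w₁, rfl⟩ := shift_dvd_of_norm_congr σ hp hσp hj γ hdw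
    have h₁ : Pm' (Ideal.Quotient.mk _ w₁) := (hPm'iff w₁).2 ((hdiv w₁).1 hdw)
    exact ⟨⟨Ideal.Quotient.mk _ w₁, h₁⟩, Subtype.ext (hgmk w₁)⟩

end Count

end Literature.NumberTheory.LocalFields.UnramifiedQuadraticNorm
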